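import Literature.Probability.LatticeModels.FKIsingInterfaceTightnessProofs
import HarnessLib

/-!
# Tightness of the critical FK-Ising interfaces (T), reduced to the RSW bound

Topic `Literature/Probability/LatticeModels` (trunk `StatMech`, family `crit-ising`). Companion
("Proofs") file of `FKIsingInterfaceSLE.lean` for its named fact
`Literature.Probability.LatticeModels.isTightAlongMesh_fkInterfaceCurve` (**(T)**: the laws of the
critical FK-Ising Dobrushin interfaces are tight as the mesh `δ → 0⁺`; Chelkak–Duminil-Copin–
Hongler–Kemppainen–Smirnov, C. R. Math. 352 (2014), §2 (Thm. 3 with Condition G, Thm. 4);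
Duminil-Copin–Smirnov, Clay Math. Proc. 15 (2012), Thm. 6.1). The discharge cannot live in
`FKIsingInterfaceSLE.lean` itself (the tightness files import it).

The printed proof (DCS 2012, §6.1, p. 27) is: RSW bound (Thm. 3.16, Duminil-Copin–Hongler–Nolin
2011) ⟹ circuits in annuli under wired boundary conditions (Lemma 6.3) ⟹ the Aizenman–Burchard
traversal bound (6.1)–(6.2) by successive conditionings ⟹ tightness (Aizenman–Burchard 1999,
Thm. 6.2 of DCS). Every arrow is a theorem of the tree:

* `fkIsing_annulusCrossing_le_of_fkIsing_rsw` (`FKIsingAnnulusCrossingRSW.lean`, Lemma 6.3),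
* `fkInterface_traversalBound_of_annulusCrossing_le` / `fkInterface_traversalBound_of_fkIsing_rsw`
  (`FKIsingInterfaceTightnessProofs.lean`, (6.1)–(6.2)),
* `isTightAlongMesh_fkInterfaceCurve_of_traversalBound` (`FKIsingInterfaceTightness.lean`, the
  Aizenman–Burchard criterion applied to the exploration polygon).

Composing them, this file records **`isTightAlongMesh_fkInterfaceCurve_of_fkIsing_rsw`**
(PROVED): (T) follows from the single named fact `fkIsing_rsw` (DCS 2012, Thm. 3.16 =
DCHN 2011, Thm. 1), the one remaining unproved input of the tightness half of crit-ising.S17 (FK).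
No statement is introduced here.

## References

* D. Chelkak, H. Duminil-Copin, C. Hongler, A. Kemppainen, S. Smirnov, *Convergence of Ising
  interfaces to Schramm's SLE curves*, C. R. Math. Acad. Sci. Paris 352 (2014) 157–161
  (arXiv:1312.0533): §2, Thm. 3 (Kemppainen–Smirnov), Thm. 4. [CDHKSCRAS2014]
* H. Duminil-Copin, S. Smirnov, *Conformal invariance of lattice models*, Clay Math. Proc. 15
  (2012) 213–276 (arXiv:1109.1549): Thm. 3.16, Thm. 6.1, Lemma 6.3, eqs. (6.1)–(6.2).
  [DuminilCopinSmirnov2012Clay]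
* H. Duminil-Copin, C. Hongler, P. Nolin, *Connection probabilities and RSW-type bounds for the
  two-dimensional FK Ising model*, Comm. Pure Appl. Math. 64 (2011) 1165–1198, Thm. 1.
-/

noncomputable section

namespace Literature.Probability.LatticeModels

/-- **(T) from the RSW bound.** The named fact `isTightAlongMesh_fkInterfaceCurve` (tightness of
the critical FK-Ising interface laws along the mesh; CDHKS 2014, §2; DCS 2012, Thm. 6.1) follows
from the RSW-type crossing bound `fkIsing_rsw` (DCS 2012, Thm. 3.16; Duminil-Copin–Hongler–Nolin
2011, Thm. 1) alone: Thm. 3.16 ⟹ Lemma 6.3 (`fkIsing_annulusCrossing_le_of_fkIsing_rsw`) ⟹ the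
traversal bound (6.2) (`fkInterface_traversalBound_of_annulusCrossing_le`) ⟹ tightness by the
Aizenman–Burchard criterion (`isTightAlongMesh_fkInterfaceCurve_of_traversalBound`). PROVED.
[cite: DuminilCopinSmirnov2012Clay, Thm. 6.1 (proof, §6.1)] [cite: CDHKSCRAS2014, §2 Thm. 3] -/
theorem isTightAlongMesh_fkInterfaceCurve_of_fkIsing_rsw (hrsw : fkIsing_rsw) :
    isTightAlongMesh_fkInterfaceCurve :=
  isTightAlongMesh_fkInterfaceCurve_of_traversalBound (fkInterface_traversalBound_of_fkIsing_rsw hrsw)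

end Literature.Probability.LatticeModels

end
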